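import Literature.Geometry.Lorentzian.CoordRicciPerturbation

/-!
# Route EIHFluxBalance — `InertialRecession`, line `sublinear-is-free-clean-window-charges`:
# the JET-SHARP `C²`-perturbation estimate for the coordinate Ricci form (slaving stub `stub_slaving`)

Helper file for the crux `stmt-FinalStateConjecture-10166`
(`Summit.FinalStateConjecture.FinalStateConjecture.Theses.EIHFluxBalance.InertialRecession`),
stub `stub_slaving`. The slaving mechanism reads the vacuum equations `Ric(g₀ + e) = 0` of the lab
metric (`g₀` the frozen modulated multi-Kerr–Schild ansatz, `e` the deviation, `→ 0` in `C³` on lab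
slabs) as `|Ric(g₀)| ≤ |Ric(g₀ + e) − Ric(g₀)|`, and the right-hand side must be bounded LINEARLY in
the `2`-jet of `e` with coefficients that are at most QUADRATIC in the first jet of `g₀` and LINEAR
in its second jet — because the jets of `g₀` (the painted velocities, accelerations, …) are not
bounded a priori, while `Ric(g₀)` is only quadratic in the first-order jets and affine in the
second-order ones ("F2", large-jet regime). The tree's estimate
`MetricCoord.IsMetricOn.abs_ricAt_sub_le` (`CoordRicciPerturbation.lean`) uses one common bound
`N` for `‖♯‖, ‖♯'‖, ‖DG‖, ‖DG'‖, ‖D²G‖` and loses this structure (`N⁵`). This file re-runs the same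
argument (Kotschwar 2014, §1.1 (5)–(8); O'Neill 1983, Ch. 3, Lemma 3.38/3.52) with three separate
bounds `s ≥ ‖♯‖, ‖♯'‖` (nondegeneracy), `n₁ ≥ ‖DG‖, ‖DG'‖`, `n₂ ≥ ‖D²G‖`:

* `norm_fderiv_sharpAt_sub_le_jet` — `‖D♯(v) − D♯'(v)‖ ≤ (2 s n₁ ‖♯−♯'‖ + s² ‖DG−DG'‖) ‖v‖`;
* `norm_fderiv_chrAt_sub_apply_le_jet` —
  `‖(DΓ−DΓ')(v)(X)‖ ≤ (3/2)(2 s n₁² ‖♯−♯'‖ + 2 s² n₁ ‖DG−DG'‖ + n₂ ‖♯−♯'‖ + s ‖D²G−D²G'‖) ‖v‖‖X‖`;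
* `norm_riemAt_sub_le_jet` —
  `‖(R−R')(X,Y)Z‖ ≤ ((15 s n₁² + 3 n₂) ‖♯−♯'‖ + 15 s² n₁ ‖DG−DG'‖ + 3 s ‖D²G−D²G'‖) ‖X‖‖Y‖‖Z‖`;
* `abs_ricAt_sub_le_jet` — **`|Ric(Y,Z) − Ric'(Y,Z)| ≤ 3 n (s³ (5 n₁² + n₂) ‖G−G'‖ + 5 s² n₁ ‖DG−DG'‖
  + s ‖D²G−D²G'‖) ‖Y‖‖Z‖`** (`n = dim E`, `s ≥ 1`);
* `abs_ricAt_le_of_ricAt_eq_zero_jet` — the form consumed by the slaving analysis: if `Ric(G) = 0`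
  at `x` then `|Ric(G')(Y,Z)|` is bounded by the same quantity, with `n₁ = ‖DG'‖ + ‖DG−DG'‖`,
  `n₂ = ‖D²G'‖ + ‖D²G−D²G'‖` (the jets of the REFERENCE field `G'`).
-/

set_option linter.dupNamespace false
set_option maxSynthPendingDepth 3

noncomputable section

open Set Filter ContinuousLinearMap Module
open scoped Topology ContDiff RealInnerProductSpace
open Literature.Geometry.Lorentzian Literature.Geometry.Lorentzian.MetricCoord

namespace Summit.FinalStateConjecture.FinalStateConjecture.Theorems.SublinearIsFree.Slaving

section Difference

variable {E : Type*} [NormedAddCommGroup E] [NormedSpace ℝ E] [CompleteSpace E]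
  {G G' : E → E →L[ℝ] E →L[ℝ] ℝ} {V : Set E} {x : E}

/-- **`‖D♯(v) − D♯'(v)‖ ≤ (2 s n₁ ‖♯−♯'‖ + s² ‖DG−DG'‖) ‖v‖`** for `‖♯‖, ‖♯'‖ ≤ s` and
`‖DG‖, ‖DG'‖ ≤ n₁` (from `D♯ − D♯' = −[(♯−♯') DG(v) ♯ + ♯' (DG−DG')(v) ♯ + ♯' DG'(v) (♯−♯')]`,
`MetricCoord.IsMetricOn.fderiv_sharpAt_sub_eq`; Kotschwar 2014, §1.1 (5)). [folklore] -/
theorem norm_fderiv_sharpAt_sub_le_jet (hG : IsMetricOn G V) (hG' : IsMetricOn G' V)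
    (hx : x ∈ V) {s n₁ : ℝ} (hs : ‖sharpAt G x‖ ≤ s) (hs' : ‖sharpAt G' x‖ ≤ s)
    (h1 : ‖fderiv ℝ G x‖ ≤ n₁) (h1' : ‖fderiv ℝ G' x‖ ≤ n₁) (v : E) :
    ‖fderiv ℝ (sharpAt G) x v - fderiv ℝ (sharpAt G') x v‖ ≤
      (2 * s * n₁ * ‖sharpAt G x - sharpAt G' x‖ + s ^ 2 * ‖fderiv ℝ G x - fderiv ℝ G' x‖)
        * ‖v‖ := by
  have hs0 : 0 ≤ s := (norm_nonneg _).trans hs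
  have hn₁ : 0 ≤ n₁ := (norm_nonneg _).trans h1
  set d₀ := ‖sharpAt G x - sharpAt G' x‖ with hd₀
  set d₁ := ‖fderiv ℝ G x - fderiv ℝ G' x‖ with hd₁
  rw [hG.fderiv_sharpAt_sub_eq hG' hx v, norm_neg]
  have t1 : ‖(sharpAt G x - sharpAt G' x).comp ((fderiv ℝ G x v).comp (sharpAt G x))‖ ≤
      d₀ * (n₁ * ‖v‖ * s) := by
    calc _ ≤ d₀ * ‖(fderiv ℝ G x v).comp (sharpAt G x)‖ := opNorm_comp_le _ _
      _ ≤ d₀ * (‖fderiv ℝ G x v‖ * ‖sharpAt G x‖) := by gcongr; exact opNorm_comp_le _ _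
      _ ≤ d₀ * (‖fderiv ℝ G x‖ * ‖v‖ * ‖sharpAt G x‖) := by gcongr; exact le_opNorm _ _
      _ ≤ d₀ * (n₁ * ‖v‖ * s) := by gcongr
  have t2 : ‖(sharpAt G' x).comp ((fderiv ℝ G x v - fderiv ℝ G' x v).comp (sharpAt G x))‖ ≤
      s * (d₁ * ‖v‖ * s) := by
    calc _ ≤ ‖sharpAt G' x‖ * ‖(fderiv ℝ G x v - fderiv ℝ G' x v).comp (sharpAt G x)‖ :=
          opNorm_comp_le _ _
      _ ≤ ‖sharpAt G' x‖ * (‖fderiv ℝ G x v - fderiv ℝ G' x v‖ * ‖sharpAt G x‖) := by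
          gcongr; exact opNorm_comp_le _ _
      _ ≤ ‖sharpAt G' x‖ * (d₁ * ‖v‖ * ‖sharpAt G x‖) := by
          gcongr
          rw [← _root_.sub_apply]
          exact le_opNorm _ _
      _ ≤ s * (d₁ * ‖v‖ * s) := by gcongr
  have t3 : ‖(sharpAt G' x).comp ((fderiv ℝ G' x v).comp (sharpAt G x - sharpAt G' x))‖ ≤
      s * (n₁ * ‖v‖ * d₀) := by
    calc _ ≤ ‖sharpAt G' x‖ * ‖(fderiv ℝ G' x v).comp (sharpAt G x - sharpAt G' x)‖ :=
          opNorm_comp_le _ _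
      _ ≤ ‖sharpAt G' x‖ * (‖fderiv ℝ G' x v‖ * d₀) := by gcongr; exact opNorm_comp_le _ _
      _ ≤ ‖sharpAt G' x‖ * (‖fderiv ℝ G' x‖ * ‖v‖ * d₀) := by gcongr; exact le_opNorm _ _
      _ ≤ s * (n₁ * ‖v‖ * d₀) := by gcongr
  calc _ ≤ d₀ * (n₁ * ‖v‖ * s) + s * (d₁ * ‖v‖ * s) + s * (n₁ * ‖v‖ * d₀) :=
        norm_add_le_of_le (norm_add_le_of_le t1 t2) t3
    _ = (2 * s * n₁ * d₀ + s ^ 2 * d₁) * ‖v‖ := by ring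

/-- **`‖(DΓ − DΓ')(v)(X)‖ ≤ (3/2)(2 s n₁² ‖♯−♯'‖ + 2 s² n₁ ‖DG−DG'‖ + n₂ ‖♯−♯'‖ + s ‖D²G−D²G'‖) ‖v‖ ‖X‖`**
for `‖♯‖, ‖♯'‖ ≤ s`, `‖DG‖, ‖DG'‖ ≤ n₁`, `‖D²G‖ ≤ n₂` (the four-term splitting
`MetricCoord.IsMetricOn.fderiv_chrAt_sub_apply_eq`; Kotschwar 2014, §1.1 (8)). [folklore] -/
theorem norm_fderiv_chrAt_sub_apply_le_jet (hG : IsMetricOn G V) (hG' : IsMetricOn G' V)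
    (hx : x ∈ V) {s n₁ n₂ : ℝ} (hs : ‖sharpAt G x‖ ≤ s) (hs' : ‖sharpAt G' x‖ ≤ s)
    (h1 : ‖fderiv ℝ G x‖ ≤ n₁) (h1' : ‖fderiv ℝ G' x‖ ≤ n₁) (h2 : ‖fderiv ℝ (fderiv ℝ G) x‖ ≤ n₂)
    (v X : E) :
    ‖fderiv ℝ (chrAt G) x v X - fderiv ℝ (chrAt G') x v X‖ ≤
      2⁻¹ * 3 * (2 * s * n₁ ^ 2 * ‖sharpAt G x - sharpAt G' x‖
        + 2 * s ^ 2 * n₁ * ‖fderiv ℝ G x - fderiv ℝ G' x‖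
        + n₂ * ‖sharpAt G x - sharpAt G' x‖
        + s * ‖fderiv ℝ (fderiv ℝ G) x - fderiv ℝ (fderiv ℝ G') x‖) * ‖v‖ * ‖X‖ := by
  have hs0 : 0 ≤ s := (norm_nonneg _).trans hs
  have hn₁ : 0 ≤ n₁ := (norm_nonneg _).trans h1
  have hn₂ : 0 ≤ n₂ := (norm_nonneg (fderiv ℝ (fderiv ℝ G) x)).trans h2
  set d₀ := ‖sharpAt G x - sharpAt G' x‖ with hd₀
  set d₁ := ‖fderiv ℝ G x - fderiv ℝ G' x‖ with hd₁
  set d₂ := ‖fderiv ℝ (fderiv ℝ G) x - fderiv ℝ (fderiv ℝ G') x‖ with hd₂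
  have hd₀0 : 0 ≤ d₀ := norm_nonneg _
  have hd₁0 : 0 ≤ d₁ := norm_nonneg _
  have hd₂0 : 0 ≤ d₂ := norm_nonneg (fderiv ℝ (fderiv ℝ G) x - fderiv ℝ (fderiv ℝ G') x)
  rw [hG.fderiv_chrAt_sub_apply_eq hG' hx v X, norm_smul, Real.norm_eq_abs,
    abs_of_pos (by norm_num : (0 : ℝ) < 2⁻¹)]
  have hKX : ‖koszulCLM G x X‖ ≤ 3 * n₁ * ‖X‖ :=
    (norm_koszulCLM_apply_le (G := G) X).trans (by gcongr)
  have t1 : ‖(fderiv ℝ (sharpAt G) x v - fderiv ℝ (sharpAt G') x v).comp (koszulCLM G x X)‖ ≤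
      (2 * s * n₁ * d₀ + s ^ 2 * d₁) * ‖v‖ * (3 * n₁ * ‖X‖) :=
    (opNorm_comp_le _ _).trans (mul_le_mul
      (norm_fderiv_sharpAt_sub_le_jet hG hG' hx hs hs' h1 h1' v) hKX (norm_nonneg _)
      (by positivity))
  have hDs' : ‖fderiv ℝ (sharpAt G') x v‖ ≤ s * n₁ * s * ‖v‖ :=
    (hG'.norm_fderiv_sharpAt_apply_le hx v).trans (by gcongr)
  have t2 : ‖(fderiv ℝ (sharpAt G') x v).comp (koszulCLM G x X - koszulCLM G' x X)‖ ≤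
      s * n₁ * s * ‖v‖ * (3 * d₁ * ‖X‖) :=
    (opNorm_comp_le _ _).trans (mul_le_mul hDs'
      (norm_koszulCLM_sub_apply_le (G := G) (G₀ := G') X) (norm_nonneg _) (by positivity))
  have t3 : ‖(sharpAt G x - sharpAt G' x).comp (koszulOp (fderiv ℝ (fderiv ℝ G) x v) X)‖ ≤
      d₀ * (3 * n₂ * ‖v‖ * ‖X‖) :=
    (opNorm_comp_le _ _).trans (mul_le_mul_of_nonneg_left
      ((norm_koszulOp_fderiv_fderiv_apply_le v X).trans (by gcongr)) hd₀0)
  have t4 : ‖(sharpAt G' x).comp (koszulOp (fderiv ℝ (fderiv ℝ G) x v) X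
      - koszulOp (fderiv ℝ (fderiv ℝ G') x v) X)‖ ≤ s * (3 * d₂ * ‖v‖ * ‖X‖) :=
    (opNorm_comp_le _ _).trans (mul_le_mul hs' (norm_koszulOp_fderiv_fderiv_sub_apply_le v X)
      (norm_nonneg _) hs0)
  have hsum := norm_add_le_of_le (norm_add_le_of_le (norm_add_le_of_le t1 t2) t3) t4
  have hv0 : 0 ≤ ‖v‖ := norm_nonneg v
  have hX0 : 0 ≤ ‖X‖ := norm_nonneg X
  calc _ ≤ 2⁻¹ * ((2 * s * n₁ * d₀ + s ^ 2 * d₁) * ‖v‖ * (3 * n₁ * ‖X‖)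
        + s * n₁ * s * ‖v‖ * (3 * d₁ * ‖X‖)
        + d₀ * (3 * n₂ * ‖v‖ * ‖X‖) + s * (3 * d₂ * ‖v‖ * ‖X‖)) :=
          mul_le_mul_of_nonneg_left hsum (by norm_num)
    _ = 2⁻¹ * 3 * (2 * s * n₁ ^ 2 * d₀ + 2 * s ^ 2 * n₁ * d₁ + n₂ * d₀ + s * d₂) * ‖v‖ * ‖X‖ := by
          ring

/-- **`‖(R − R')(X,Y)Z‖ ≤ ((15 s n₁² + 3 n₂) ‖♯−♯'‖ + 15 s² n₁ ‖DG−DG'‖ + 3 s ‖D²G−D²G'‖) ‖X‖‖Y‖‖Z‖`**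
for `‖♯‖, ‖♯'‖ ≤ s`, `‖DG‖, ‖DG'‖ ≤ n₁`, `‖D²G‖ ≤ n₂` (`R − R' = DA − DA + riemRem`,
`MetricCoord.riemAt_sub_eq`, `MetricCoord.norm_riemRem_le` with `‖Γ‖, ‖Γ'‖ ≤ (3/2) s n₁`;
Kotschwar 2014, §1.1 (8)). [folklore] -/
theorem norm_riemAt_sub_le_jet (hG : IsMetricOn G V) (hG' : IsMetricOn G' V)
    (hx : x ∈ V) {s n₁ n₂ : ℝ} (hs : ‖sharpAt G x‖ ≤ s) (hs' : ‖sharpAt G' x‖ ≤ s)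
    (h1 : ‖fderiv ℝ G x‖ ≤ n₁) (h1' : ‖fderiv ℝ G' x‖ ≤ n₁) (h2 : ‖fderiv ℝ (fderiv ℝ G) x‖ ≤ n₂)
    (X Y Z : E) :
    ‖riemAt G x X Y Z - riemAt G' x X Y Z‖ ≤
      ((15 * s * n₁ ^ 2 + 3 * n₂) * ‖sharpAt G x - sharpAt G' x‖
        + 15 * s ^ 2 * n₁ * ‖fderiv ℝ G x - fderiv ℝ G' x‖
        + 3 * s * ‖fderiv ℝ (fderiv ℝ G) x - fderiv ℝ (fderiv ℝ G') x‖) * ‖X‖ * ‖Y‖ * ‖Z‖ := by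
  have hs0 : 0 ≤ s := (norm_nonneg _).trans hs
  have hn₁ : 0 ≤ n₁ := (norm_nonneg _).trans h1
  have hn₂ : 0 ≤ n₂ := (norm_nonneg (fderiv ℝ (fderiv ℝ G) x)).trans h2
  set d₀ := ‖sharpAt G x - sharpAt G' x‖ with hd₀
  set d₁ := ‖fderiv ℝ G x - fderiv ℝ G' x‖ with hd₁
  set d₂ := ‖fderiv ℝ (fderiv ℝ G) x - fderiv ℝ (fderiv ℝ G') x‖ with hd₂
  have hd₀0 : 0 ≤ d₀ := norm_nonneg _
  have hd₁0 : 0 ≤ d₁ := norm_nonneg _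
  have hd₂0 : 0 ≤ d₂ := norm_nonneg (fderiv ℝ (fderiv ℝ G) x - fderiv ℝ (fderiv ℝ G') x)
  set C := 2⁻¹ * 3 * (2 * s * n₁ ^ 2 * d₀ + 2 * s ^ 2 * n₁ * d₁ + n₂ * d₀ + s * d₂) with hC
  have hC0 : 0 ≤ C := by positivity
  -- the `DA` terms
  have hDA : ∀ U W : E, ‖(fderiv ℝ (chrAt G) x - fderiv ℝ (chrAt G') x) U W Z‖ ≤
      C * ‖U‖ * ‖W‖ * ‖Z‖ := by
    intro U W
    have h := norm_fderiv_chrAt_sub_apply_le_jet hG hG' hx hs hs' h1 h1' h2 U W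
    calc ‖(fderiv ℝ (chrAt G) x - fderiv ℝ (chrAt G') x) U W Z‖
        = ‖(fderiv ℝ (chrAt G) x U W - fderiv ℝ (chrAt G') x U W) Z‖ := by
            simp only [_root_.sub_apply]
      _ ≤ ‖fderiv ℝ (chrAt G) x U W - fderiv ℝ (chrAt G') x U W‖ * ‖Z‖ := le_opNorm _ _
      _ ≤ C * ‖U‖ * ‖W‖ * ‖Z‖ := by rw [hC]; gcongr
  -- the `A` terms: `‖Γ‖, ‖Γ'‖ ≤ (3/2) s n₁`, `‖A‖ ≤ (3/2)(d₀ n₁ + s d₁)`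
  have hΓ : ‖chrAt G x‖ ≤ 2⁻¹ * 3 * s * n₁ := by
    refine opNorm_le_bound _ (by positivity) fun U ↦ ?_
    calc ‖chrAt G x U‖ ≤ 2⁻¹ * (‖sharpAt G x‖ * (3 * ‖fderiv ℝ G x‖ * ‖U‖)) :=
          norm_chrAt_apply_le U
      _ ≤ 2⁻¹ * (s * (3 * n₁ * ‖U‖)) := by gcongr
      _ = 2⁻¹ * 3 * s * n₁ * ‖U‖ := by ring
  have hΓ' : ‖chrAt G' x‖ ≤ 2⁻¹ * 3 * s * n₁ := by
    refine opNorm_le_bound _ (by positivity) fun U ↦ ?_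
    calc ‖chrAt G' x U‖ ≤ 2⁻¹ * (‖sharpAt G' x‖ * (3 * ‖fderiv ℝ G' x‖ * ‖U‖)) :=
          norm_chrAt_apply_le U
      _ ≤ 2⁻¹ * (s * (3 * n₁ * ‖U‖)) := by gcongr
      _ = 2⁻¹ * 3 * s * n₁ * ‖U‖ := by ring
  have hA : ‖chrDiff G G' x‖ ≤ 2⁻¹ * 3 * (d₀ * n₁ + s * d₁) := by
    rw [chrDiff_apply]
    refine opNorm_le_bound _ (by positivity) fun U ↦ ?_
    rw [_root_.sub_apply]
    calc ‖chrAt G x U - chrAt G' x U‖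
        ≤ 2⁻¹ * (3 * (‖sharpAt G x - sharpAt G' x‖ * ‖fderiv ℝ G x‖
            + ‖sharpAt G' x‖ * ‖fderiv ℝ G x - fderiv ℝ G' x‖) * ‖U‖) :=
          norm_chrAt_sub_chrAt_apply_le U
      _ ≤ 2⁻¹ * (3 * (d₀ * n₁ + s * d₁) * ‖U‖) := by gcongr
      _ = 2⁻¹ * 3 * (d₀ * n₁ + s * d₁) * ‖U‖ := by ring
  have hrem := norm_riemRem_le (G := G) (G' := G') (x := x) hΓ hΓ' X Y Z
  have hrem' : ‖riemRem G G' x X Y Z‖ ≤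
      4 * (2⁻¹ * 3 * s * n₁) * (2⁻¹ * 3 * (d₀ * n₁ + s * d₁)) * ‖X‖ * ‖Y‖ * ‖Z‖ :=
    hrem.trans (by gcongr)
  rw [riemAt_sub_eq]
  calc _ ≤ C * ‖X‖ * ‖Y‖ * ‖Z‖ + C * ‖Y‖ * ‖X‖ * ‖Z‖
        + 4 * (2⁻¹ * 3 * s * n₁) * (2⁻¹ * 3 * (d₀ * n₁ + s * d₁)) * ‖X‖ * ‖Y‖ * ‖Z‖ :=
          norm_add_le_of_le (norm_sub_le_of_le (hDA X Y) (hDA Y X)) hrem'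
    _ = ((15 * s * n₁ ^ 2 + 3 * n₂) * d₀ + 15 * s ^ 2 * n₁ * d₁ + 3 * s * d₂)
        * ‖X‖ * ‖Y‖ * ‖Z‖ := by rw [hC]; ring

end Difference

/-! ### The Ricci difference, jet-sharp form -/

section Ricci

variable {E : Type*} [NormedAddCommGroup E] [InnerProductSpace ℝ E] [FiniteDimensional ℝ E]
  [CompleteSpace E] {G G' : E → E →L[ℝ] E →L[ℝ] ℝ} {V : Set E} {x : E}

/-- **The jet-sharp `C²`-perturbation estimate for the Ricci form**: for two fields of metric
components on `V ∋ x` with `‖♯‖, ‖♯'‖ ≤ s` (`s ≥ 1`), `‖DG‖, ‖DG'‖ ≤ n₁`, `‖D²G‖ ≤ n₂` at `x`,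
`|Ric(Y,Z) − Ric'(Y,Z)| ≤ 3 n (s³ (5 n₁² + n₂) ‖G−G'‖ + 5 s² n₁ ‖DG−DG'‖ + s ‖D²G−D²G'‖) ‖Y‖ ‖Z‖`
at `x` (`n = dim E`; `‖♯ − ♯'‖ ≤ s² ‖G − G'‖`, `MetricCoord.norm_sharpAt_sub_le`). The bound is
linear in the `2`-jet of `G − G'`, quadratic in the first jets and linear in the second jet of the
two fields — the structure of `Ric = ♯·D²G + ♯♯·DG·DG` (O'Neill 1983, Ch. 3, Lemma 3.52).
[folklore] -/
theorem abs_ricAt_sub_le_jet (hG : IsMetricOn G V) (hG' : IsMetricOn G' V) (hx : x ∈ V)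
    {s n₁ n₂ : ℝ} (h1s : 1 ≤ s) (hs : ‖sharpAt G x‖ ≤ s) (hs' : ‖sharpAt G' x‖ ≤ s)
    (h1 : ‖fderiv ℝ G x‖ ≤ n₁) (h1' : ‖fderiv ℝ G' x‖ ≤ n₁) (h2 : ‖fderiv ℝ (fderiv ℝ G) x‖ ≤ n₂)
    (Y Z : E) :
    |ricAt G x Y Z - ricAt G' x Y Z| ≤ 3 * Module.finrank ℝ E *
      (s ^ 3 * (5 * n₁ ^ 2 + n₂) * ‖G x - G' x‖ + 5 * s ^ 2 * n₁ * ‖fderiv ℝ G x - fderiv ℝ G' x‖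
        + s * ‖fderiv ℝ (fderiv ℝ G) x - fderiv ℝ (fderiv ℝ G') x‖) * ‖Y‖ * ‖Z‖ := by
  have hs0 : 0 ≤ s := zero_le_one.trans h1s
  have hn₁ : 0 ≤ n₁ := (norm_nonneg _).trans h1
  have hn₂ : 0 ≤ n₂ := (norm_nonneg (fderiv ℝ (fderiv ℝ G) x)).trans h2
  set b := stdOrthonormalBasis ℝ E with hb
  set d₀ := ‖sharpAt G x - sharpAt G' x‖ with hd₀
  set dH := ‖G x - G' x‖ with hdH
  set d₁ := ‖fderiv ℝ G x - fderiv ℝ G' x‖ with hd₁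
  set d₂ := ‖fderiv ℝ (fderiv ℝ G) x - fderiv ℝ (fderiv ℝ G') x‖ with hd₂
  have hd₁0 : 0 ≤ d₁ := norm_nonneg _
  have hd₂0 : 0 ≤ d₂ := norm_nonneg (fderiv ℝ (fderiv ℝ G) x - fderiv ℝ (fderiv ℝ G') x)
  have hdH0 : 0 ≤ dH := norm_nonneg _
  -- `‖♯ − ♯'‖ ≤ s² ‖G − G'‖`
  have hd₀ : d₀ ≤ s ^ 2 * dH := by
    calc d₀ ≤ ‖sharpAt G x‖ * ‖G x - G' x‖ * ‖sharpAt G' x‖ :=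
          norm_sharpAt_sub_le (hG.isInvertible x hx) (hG'.isInvertible x hx)
      _ ≤ s * dH * s := by gcongr
      _ = s ^ 2 * dH := by ring
  -- termwise
  have hsub : ricAt G x Y Z - ricAt G' x Y Z =
      ∑ i, ⟪b i, riemAt G x (b i) Y Z - riemAt G' x (b i) Y Z⟫ := by
    rw [ricAt_eq_sum_inner b, ricAt_eq_sum_inner b, ← Finset.sum_sub_distrib]
    refine Finset.sum_congr rfl fun i _ ↦ ?_
    rw [inner_sub_right]
  set K := (15 * s * n₁ ^ 2 + 3 * n₂) * d₀ + 15 * s ^ 2 * n₁ * d₁ + 3 * s * d₂ with hK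
  have hterm : ∀ i, |⟪b i, riemAt G x (b i) Y Z - riemAt G' x (b i) Y Z⟫| ≤ K * ‖Y‖ * ‖Z‖ := by
    intro i
    have ha := abs_real_inner_le_norm (b i) (riemAt G x (b i) Y Z - riemAt G' x (b i) Y Z)
    rw [b.orthonormal.1 i, one_mul] at ha
    have hb' := norm_riemAt_sub_le_jet hG hG' hx hs hs' h1 h1' h2 (b i) Y Z
    rw [b.orthonormal.1 i, mul_one] at hb'
    exact ha.trans hb'
  rw [hsub]
  have hY0 := norm_nonneg Y
  have hZ0 := norm_nonneg Z
  have hn0 : (0 : ℝ) ≤ Module.finrank ℝ E := Nat.cast_nonneg _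
  calc |∑ i, ⟪b i, riemAt G x (b i) Y Z - riemAt G' x (b i) Y Z⟫|
      ≤ ∑ i, |⟪b i, riemAt G x (b i) Y Z - riemAt G' x (b i) Y Z⟫| := Finset.abs_sum_le_sum_abs _ _
    _ ≤ ∑ _i : Fin (Module.finrank ℝ E), K * ‖Y‖ * ‖Z‖ := Finset.sum_le_sum fun i _ ↦ hterm i
    _ = Module.finrank ℝ E * (K * ‖Y‖ * ‖Z‖) := by
        rw [Finset.sum_const, Finset.card_univ, Fintype.card_fin, nsmul_eq_mul]
    _ ≤ Module.finrank ℝ E * ((3 * (s ^ 3 * (5 * n₁ ^ 2 + n₂) * dH + 5 * s ^ 2 * n₁ * d₁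
        + s * d₂)) * ‖Y‖ * ‖Z‖) := by
        have key : K ≤ 3 * (s ^ 3 * (5 * n₁ ^ 2 + n₂) * dH + 5 * s ^ 2 * n₁ * d₁ + s * d₂) := by
          rw [hK]
          have e1 : (15 * s * n₁ ^ 2 + 3 * n₂) * d₀ ≤ (15 * s * n₁ ^ 2 + 3 * n₂) * (s ^ 2 * dH) :=
            mul_le_mul_of_nonneg_left hd₀ (by positivity)
          have e2 : 3 * n₂ * (s ^ 2 * dH) ≤ 3 * n₂ * (s ^ 3 * dH) := by
            have : s ^ 2 ≤ s ^ 3 := pow_le_pow_right₀ h1s (by norm_num)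
            have h' : s ^ 2 * dH ≤ s ^ 3 * dH := mul_le_mul_of_nonneg_right this hdH0
            exact mul_le_mul_of_nonneg_left h' (by positivity)
          nlinarith [e1, e2]
        gcongr
    _ = _ := by ring

/-- **The form consumed by the slaving analysis**: if `Ric(G) = 0` at `x` (the lab metric of a
vacuum spacetime read in a chart, `ricAt_deviationExtend_add_bilin_eq_zero`), then for the reference
field `G'` (the frozen ansatz),
`|Ric(G')(Y,Z)| ≤ 3 n (s³ (5 n₁² + n₂) ‖G−G'‖ + 5 s² n₁ ‖DG−DG'‖ + s ‖D²G−D²G'‖) ‖Y‖ ‖Z‖` with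
`n₁ = ‖DG'‖ + ‖DG−DG'‖`, `n₂ = ‖D²G'‖ + ‖D²G−D²G'‖`: the Ricci form of the reference field is small,
linearly in the `C²`-size of the deviation, RELATIVE TO ITS OWN `2`-JET (quadratic in `‖DG'‖`,
linear in `‖D²G'‖`). [folklore] -/
theorem abs_ricAt_le_of_ricAt_eq_zero_jet (hG : IsMetricOn G V) (hG' : IsMetricOn G' V)
    (hx : x ∈ V) (h0 : ricAt G x = 0) {s : ℝ} (h1s : 1 ≤ s) (hs : ‖sharpAt G x‖ ≤ s)
    (hs' : ‖sharpAt G' x‖ ≤ s) (Y Z : E) :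
    |ricAt G' x Y Z| ≤ 3 * Module.finrank ℝ E *
      (s ^ 3 * (5 * (‖fderiv ℝ G' x‖ + ‖fderiv ℝ G x - fderiv ℝ G' x‖) ^ 2
          + (‖fderiv ℝ (fderiv ℝ G') x‖ + ‖fderiv ℝ (fderiv ℝ G) x - fderiv ℝ (fderiv ℝ G') x‖))
          * ‖G x - G' x‖
        + 5 * s ^ 2 * (‖fderiv ℝ G' x‖ + ‖fderiv ℝ G x - fderiv ℝ G' x‖)
          * ‖fderiv ℝ G x - fderiv ℝ G' x‖
        + s * ‖fderiv ℝ (fderiv ℝ G) x - fderiv ℝ (fderiv ℝ G') x‖) * ‖Y‖ * ‖Z‖ := by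
  have h1 : ‖fderiv ℝ G x‖ ≤ ‖fderiv ℝ G' x‖ + ‖fderiv ℝ G x - fderiv ℝ G' x‖ :=
    norm_le_insert' (fderiv ℝ G x) (fderiv ℝ G' x)
  have h1' : ‖fderiv ℝ G' x‖ ≤ ‖fderiv ℝ G' x‖ + ‖fderiv ℝ G x - fderiv ℝ G' x‖ :=
    le_add_of_nonneg_right (norm_nonneg _)
  have h2 : ‖fderiv ℝ (fderiv ℝ G) x‖ ≤
      ‖fderiv ℝ (fderiv ℝ G') x‖ + ‖fderiv ℝ (fderiv ℝ G) x - fderiv ℝ (fderiv ℝ G') x‖ :=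
    norm_le_insert' (fderiv ℝ (fderiv ℝ G) x) (fderiv ℝ (fderiv ℝ G') x)
  have h := abs_ricAt_sub_le_jet hG hG' hx h1s hs hs' h1 h1' h2 Y Z
  rwa [h0, zero_apply, zero_apply, zero_sub, abs_neg] at h

/-- **Registered sub-goal form** (worker carrier `slaving_abs_ricAt_le_of_vacuum_jet` of the crux
item) of `abs_ricAt_le_of_ricAt_eq_zero_jet`, specialised to the lab chart `E4`: the Ricci form of
the reference field is controlled, linearly in the `C²` deviation and relative to its own `2`-jet,
wherever the lab metric is Ricci-flat. [folklore] -/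
theorem slaving_abs_ricAt_le_of_vacuum_jet : open Literature.Geometry.Lorentzian in ∀ {G G' : E4 → E4 →L[ℝ] E4 →L[ℝ] ℝ} {V : Set E4} {x : E4}, MetricCoord.IsMetricOn G V → MetricCoord.IsMetricOn G' V → x ∈ V → MetricCoord.ricAt G x = 0 → ∀ {s : ℝ}, 1 ≤ s → ‖MetricCoord.sharpAt G x‖ ≤ s → ‖MetricCoord.sharpAt G' x‖ ≤ s → ∀ (Y Z : E4), |MetricCoord.ricAt G' x Y Z| ≤ 3 * Module.finrank ℝ E4 * (s ^ 3 * (5 * (‖fderiv ℝ G' x‖ + ‖fderiv ℝ G x - fderiv ℝ G' x‖) ^ 2 + (‖fderiv ℝ (fderiv ℝ G') x‖ + ‖fderiv ℝ (fderiv ℝ G) x - fderiv ℝ (fderiv ℝ G') x‖)) * ‖G x - G' x‖ + 5 * s ^ 2 * (‖fderiv ℝ G' x‖ + ‖fderiv ℝ G x - fderiv ℝ G' x‖) * ‖fderiv ℝ G x - fderiv ℝ G' x‖ + s * ‖fderiv ℝ (fderiv ℝ G) x - fderiv ℝ (fderiv ℝ G') x‖) * ‖Y‖ * ‖Z‖ 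:=
  fun hG hG' hx h0 _ h1s hs hs' Y Z ↦ abs_ricAt_le_of_ricAt_eq_zero_jet hG hG' hx h0 h1s hs hs' Y Z

end Ricci

end Summit.FinalStateConjecture.FinalStateConjecture.Theorems.SublinearIsFree.Slaving

end
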